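import Summits.NavierStokesRegularity.NavierStokesRegularity.Theorems.ExtremiserTransienceNearExtremalTransienceExtremiserLiouvilleConstantSpeedSlideQuotientLimit
import HarnessLib

/-!
# Crux `ExtremiserTransience.NearExtremalTransience` (stmt-NavierStokesRegularity-21883), line `extremiser_liouville`,
# stub K1b — THE CURL OF THE DISCRETE SLIDE DIRECTION (input of the palinstrophy bound, record §13 R2)

`--supports stmt-NavierStokesRegularity-21883` (helper).  Author: prover seat `ns-el-k1b` (g8).
With `Ψ = g(x₂)V`, `G = g′(x₂)V₂`, `F_h = ∫_{−h}^{0}G(·+te₂)dt`, `φ̂_h = Ψ − Ψ(·−he₂) − F_h e₂`: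
* `curl_axialWeight_smul_eq` : **`curl(g(x₂)V) = g(x₂)·curl V + g′(x₂)·(−V₁, V₀, 0)`** (`= gω + g′ e₂ × V`);
* `hasFDerivAt_curl_axialWeight_smul` : `D(curl(gV)) = gDω + ω⊗g′dx₂ + g′DB + B⊗g″dx₂`, `B = (−V₁,V₀,0)` (so `Rᵢ` of §13 is
  explicit in `V, DV, g′, g″`);
* `curl_slideQuotient_eq` : **`curl φ̂_h = curl Ψ − (curl Ψ)(·−he₂) − curlCLM((∫_{−h}^{0}DG(·+te₂)dt) ⊗ e₂)`**
  (curl is `curlCLM ∘ D`, `D` commutes with translation, `D` of the sliding integral = sliding integral of `DG`).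
Differentiating once more and splitting `∂ᵢcurl Ψ = g∂ᵢω + Rᵢ` gives the decomposition of record §13 (R2) on which the shifted
discrete product rule (…DiscreteProductRuleShift) acts.

WHAT THIS IS NOT: K1b is NOT proved; nothing here proves NS regularity. [folklore]
-/

noncomputable section

open Set Filter Topology MeasureTheory Metric Function InnerProductSpace
open scoped ENNReal NNReal Topology InnerProductSpace RealInnerProductSpace ContDiff
open Literature.Analysis.FluidPDE Literature.Analysis

namespace Summit.NavierStokesRegularity.NavierStokesRegularity.Theorems

-- the problem directory repeats the summit name (`NavierStokesRegularity/NavierStokesRegularity`)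
set_option linter.dupNamespace false

namespace ExtremiserLiouville

open DepletionLadder.KStar

variable {V : EuclideanSpace ℝ (Fin 3) → EuclideanSpace ℝ (Fin 3)} {g : ℝ → ℝ}

/-- **`curl(g(x₂)V) = g(x₂)·curl V + g′(x₂)·(−V₁, V₀, 0)`**. [folklore] -/
theorem curl_axialWeight_smul_eq (hVd : Differentiable ℝ V) (hgd : Differentiable ℝ g) (x : EuclideanSpace ℝ (Fin 3)) :
    curl (fun y : EuclideanSpace ℝ (Fin 3) => g (y 2) • V y) x =
      g (x 2) • curl V x +
        deriv g (x 2) • ((-V x 1) • EuclideanSpace.single (0 : Fin 3) (1 : ℝ) + (V x 0) • EuclideanSpace.single (1 : Fin 3) (1 : ℝ)) := by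
  have hD := (hasFDerivAt_axialWeight_smul hVd hgd x).fderiv
  ext i
  fin_cases i <;>
  · simp only [curl]
    rw [hD]
    simp
    ring

/-- **The curl of the discrete slide direction**:
`curl φ̂_h(x) = curl Ψ(x) − curl Ψ(x − he₂) − curlCLM((∫_{−h}^{0}DG(x+te₂)dt) ⊗ e₂)`, `Ψ = g(x₂)V`, `G = g′(x₂)V₂`. [folklore] -/
theorem curl_slideQuotient_eq (hV : ContDiff ℝ ∞ V) (hg : ContDiff ℝ ∞ g) (h : ℝ) (x : EuclideanSpace ℝ (Fin 3)) :
    curl (fun x : EuclideanSpace ℝ (Fin 3) =>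
        g (x 2) • V x - g ((x + (-h) • EuclideanSpace.single (2 : Fin 3) (1 : ℝ)) 2) •
            V (x + (-h) • EuclideanSpace.single (2 : Fin 3) (1 : ℝ)) -
          (∫ t in (-h)..0, deriv g ((x + t • EuclideanSpace.single (2 : Fin 3) (1 : ℝ)) 2) *
              V (x + t • EuclideanSpace.single (2 : Fin 3) (1 : ℝ)) 2) • EuclideanSpace.single (2 : Fin 3) (1 : ℝ)) x =
      curl (fun z : EuclideanSpace ℝ (Fin 3) => g (z 2) • V z) x -
        curl (fun z : EuclideanSpace ℝ (Fin 3) => g (z 2) • V z) (x + (-h) • EuclideanSpace.single (2 : Fin 3) (1 : ℝ)) -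
        curlCLM ((∫ t in (-h)..0, fderiv ℝ (fun z : EuclideanSpace ℝ (Fin 3) => deriv g (z 2) * V z 2)
          (x + t • EuclideanSpace.single (2 : Fin 3) (1 : ℝ))).smulRight (EuclideanSpace.single (2 : Fin 3) (1 : ℝ))) := by
  rw [curl_eq_curlCLM, curl_eq_curlCLM, curl_eq_curlCLM, fderiv_slideQuotient_eq hV hg h x, map_sub, map_sub]

/-- **The derivative of `curl(g(x₂)V)`**: with `ω = curl V`, `B = (−V₁, V₀, 0)`,
`D(curl(gV))(x) = g(x₂)Dω(x) + ω(x) ⊗ g′(x₂)dx₂ + g′(x₂)DB(x) + B(x) ⊗ g″(x₂)dx₂`; the last three terms are the field `R`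
of record §13 (R2) (only `V, DV` and `g′, g″`), the first is `g∂ω`. [folklore] -/
theorem hasFDerivAt_curl_axialWeight_smul (hV : ContDiff ℝ 2 V) (hg : ContDiff ℝ 2 g) (x : EuclideanSpace ℝ (Fin 3)) :
    HasFDerivAt (curl (fun y : EuclideanSpace ℝ (Fin 3) => g (y 2) • V y))
      (g (x 2) • fderiv ℝ (curl V) x +
          (deriv g (x 2) • (EuclideanSpace.proj (2 : Fin 3) : EuclideanSpace ℝ (Fin 3) →L[ℝ] ℝ)).smulRight (curl V x) +
        (deriv g (x 2) • fderiv ℝ (fun z : EuclideanSpace ℝ (Fin 3) =>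
            (-V z 1) • EuclideanSpace.single (0 : Fin 3) (1 : ℝ) + (V z 0) • EuclideanSpace.single (1 : Fin 3) (1 : ℝ)) x +
          (deriv (deriv g) (x 2) • (EuclideanSpace.proj (2 : Fin 3) : EuclideanSpace ℝ (Fin 3) →L[ℝ] ℝ)).smulRight
            ((-V x 1) • EuclideanSpace.single (0 : Fin 3) (1 : ℝ) + (V x 0) • EuclideanSpace.single (1 : Fin 3) (1 : ℝ)))) x := by
  have hVd : Differentiable ℝ V := hV.differentiable two_ne_zero
  have hgd : Differentiable ℝ g := hg.differentiable two_ne_zero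
  have hg'c : ContDiff ℝ 1 (deriv g) := by
    have h2 : ContDiff ℝ (1 + 1) g := by rw [show ((1 : WithTop ℕ∞) + 1) = 2 by norm_num]; exact hg
    exact h2.deriv'
  have hg'd : Differentiable ℝ (deriv g) := hg'c.differentiable one_ne_zero
  have hωd : Differentiable ℝ (curl V) := (contDiff_curl (n := 1) hV).differentiable one_ne_zero
  set B : EuclideanSpace ℝ (Fin 3) → EuclideanSpace ℝ (Fin 3) := fun z =>
    (-V z 1) • EuclideanSpace.single (0 : Fin 3) (1 : ℝ) + (V z 0) • EuclideanSpace.single (1 : Fin 3) (1 : ℝ) with hB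
  have hV0 : Differentiable ℝ fun z => V z 0 := fun z =>
    ((EuclideanSpace.proj (0 : Fin 3) : EuclideanSpace ℝ (Fin 3) →L[ℝ] ℝ).hasFDerivAt.comp z (hVd z).hasFDerivAt).differentiableAt
  have hV1 : Differentiable ℝ fun z => V z 1 := fun z =>
    ((EuclideanSpace.proj (1 : Fin 3) : EuclideanSpace ℝ (Fin 3) →L[ℝ] ℝ).hasFDerivAt.comp z (hVd z).hasFDerivAt).differentiableAt
  have hBd : Differentiable ℝ B := (hV1.neg.smul_const _).add (hV0.smul_const _)
  have hfun : curl (fun y : EuclideanSpace ℝ (Fin 3) => g (y 2) • V y) = fun y => g (y 2) • curl V y + deriv g (y 2) • B y := by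
    funext y; exact curl_axialWeight_smul_eq hVd hgd y
  rw [hfun]
  exact ((hasFDerivAt_comp_coord hgd 2 x).smul (hωd x).hasFDerivAt).add
    ((hasFDerivAt_comp_coord hg'd 2 x).smul (hBd x).hasFDerivAt)

end ExtremiserLiouville

end Summit.NavierStokesRegularity.NavierStokesRegularity.Theorems

end
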